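import Summits.BirchSwinnertonDyer.Rank1Residual.Supersingular.SignedRankOneCorA5
import Summits.BirchSwinnertonDyer.Rank1Residual.Partition.MainConjecturesCMSupersingular
import Literature.NumberTheory.EllipticCurves.FouquetWan2021.KatoMainConjecturePPartOPEN
import HarnessLib

/-!
# Fouquet–Wan Thm 5.1 (PREPRINT) read through Kobayashi 2003 Thm 7.4, as an explicitly labelled OPEN
# hypothesis in the ± currency, and the conditional class theorems it would give on the X7 Fouquet–Wan locus
# in EITHER analytic rank (cell `bsd-ssimc`, seat `bsd-ssimc-lev` gen 5, order W-lev-9)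

HONEST FRAMING: an UNREFEREED preprint enters the tree ONLY as an explicitly labelled OPEN hypothesis,
never as a theorem; nothing is asserted about any curve; nothing is booked. Pattern of
`BurungaleSkinnerTianWan2024_thm13_OPEN` (this directory, `KobayashiMainConjecture.lean`): ONE `def … : Prop`
(the OPEN binder) and theorems taking it as an explicit hypothesis.

Why a SECOND binder next to `Literature…FouquetWan2021.cor54_pPart_rankZero_OPEN` (p412876): that one is
Fouquet–Wan's Cor 5.4 — the rank-0 BSD consequence — in print shape, and it reaches the rank-0 part of the
locus only. Their Thm 5.1 itself concludes Kato's main conjecture (Conj 12.10) for `M(f_E)`, which at a good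
supersingular prime with `a_p = 0` is EQUIVALENT to each of Kobayashi's even/odd main conjectures (Kobayashi,
Invent. Math. 152 (2003), Thm 7.4 p. 13, via the exact sequences (7.21); PUBLISHED). The tree has no
predicate "Kato's main conjecture for `E` at `p`" (only the per-datum interface `KatoDescentDatum.Conj1210`
of cell bsd-potss), but it has the ± main conjecture on the real objects, `KobayashiMainConjecture W p ε`
(this directory). So the statement «FW Thm 5.1 ∘ Kobayashi Thm 7.4» is typed DIRECTLY in the ± currency —
the composite is named honestly in the identifier and the docstring; the Kobayashi step is a published
theorem, the Fouquet–Wan step the PRE claim. With it the planner's registered stub `stub_fwLocus` of crux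
`KobayashiLowerHalfLargeImage` (route `SignedLowerHalves`, item stmt-BirchSwinnertonDyer-19001) is closed
MODULO this one OPEN binder in BOTH ranks (`X7.kobayashiLowerDivisibility_of_thm51_OPEN`), and the BSD
consequences follow from the tree's class roads: rank 1 via Burungale–Kobayashi–Ota 2024 Cor A.5
(`bsdp_of_kobayashiMainConjecture_of_corA5_of_analyticRank_eq_one`), rank 0 via the image-free ± road
(`bsdp_of_kobayashiMainConjecture_of_analyticRank_eq_zero`).

Source and audit: `paper:arxiv-2107.13726` p0053 (Thm 5.1), p0050 (Thm 4.51 = the crystalline short case,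
which is what an X7 pair consumes at `p ≥ 5` with surjective image); the seat's audit MEMO-5 + addA + addB
(HOME/bsd-ssimc-lev/): no located obstruction at statement level; imports Wan 2015 (superseded) for
constructions re-pointable to Castella–Liu–Wan FMS 2022; at `p = 3` the integral Kato input wants the
SL₂(ℤ₃)-image (flag A-KATO-3). FRESHNESS 2026-08-26: arXiv only.

References: [FouquetWan2021] Thm 5.1 / 1.7, Thm 4.51; [Kobayashi2003] Thm 7.4 (p. 13), Conjecture (p. 2);
[BurungaleKobayashiOta2023] App. A Cor. A.5; [BDKim2013] Cor. 3.15; [Pollack2003]; [Miller2011LMS] Def 1.1.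
-/

set_option autoImplicit false

noncomputable section

open scoped Classical MatrixGroups ModularForm

open CongruenceSubgroup WeierstrassCurve Literature.NumberTheory.EllipticCurves
  Literature.NumberTheory.EllipticCurves.ModularForms
  Literature.NumberTheory.EllipticCurves.Rank1Residual
  Literature.NumberTheory.EllipticCurves.Rank1Residual.Typed
  Literature.NumberTheory.EllipticCurves.Kobayashi2003

namespace Summit.BirchSwinnertonDyer.Rank1Residual.Supersingular

/-- **OPEN HYPOTHESIS — UNREFEREED PREPRINT (Fouquet–Wan, arXiv:2107.13726, 2021), Thm 5.1, READ THROUGH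
Kobayashi 2003 Thm 7.4 (published).** FW Thm 5.1 (p. 53): for `p ≥ 3`, `f ∈ S_k(Γ₀(Np^r))`, if `ρ̄_f` is
absolutely irreducible, `ρ̄_f|G_{ℚ_p}`ˢˢ `≠ χ̄ ⊕ χ̄_cyc χ̄`, and there is `ℓ ∤ p`, `ℓ ∥ N`, with `ρ̄_f|G_ℓ` a
RAMIFIED extension of `μχ^{−k/2}` by `μχ^{1−k/2}`, `μ` unramified quadratic and NON-trivial when
`ρ̄_f|G_{ℚ_p}` is irreducible, then Kato's main conjecture (Conj 12.10, equality of characteristic ideals)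
holds for `M(f)`. Kobayashi Thm 7.4: for `E/ℚ`, `p` odd of good reduction with `a_p = 0`, Kato's main
conjecture is equivalent to each signed main conjecture `Char(X^±) = (L_p^±)`. TRANSCRIBED (elliptic curve,
`k = 2`, `r = 0`): `p ≠ 2`, good at `p`, `a_p = 0` (then `ρ̄|G_p` is irreducible, so `μ` must be
non-trivial), `E[p]` irreducible, a prime `ℓ ≠ p` of NON-SPLIT multiplicative reduction with `E[p]` ramified
at `ℓ` (`p ∤ ord_ℓ Δ_min`) ⇒ `KobayashiMainConjecture W p ε` for every sign `ε`. NEVER cite this `Prop` as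
a theorem; it is the conjunction «FW Thm 5.1 (PRE) ∘ Kobayashi Thm 7.4 (PUB)» stated in the tree's ±
currency because no Kato-main-conjecture predicate for `E` exists in the tree.
[claim: FouquetWan2021, status: under-review] [cite: Kobayashi2003, Thm. 7.4 (p. 13)] -/
def FouquetWan2021_thm51_via_kobayashi74_OPEN : Prop :=
  ∀ (W : WeierstrassCurve ℚ) [W.IsElliptic] [W.IsGloballyMinimal] (p : ℕ) [Fact p.Prime],
    p ≠ 2 → W.HasGoodReductionAtPrime p → W.frobeniusTrace p = 0 → Irr W p →
    (∃ (ℓ : ℕ) (_ : Fact ℓ.Prime), ℓ ≠ p ∧ W.HasMultiplicativeReductionAtPrime ℓ ∧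
        ¬ W.HasSplitMultiplicativeReductionAtPrime ℓ ∧ ¬ p ∣ padicValInt ℓ W.minimalDiscriminantInt) →
    ∀ ε : ℤˣ, KobayashiMainConjecture W p ε

variable (W : WeierstrassCurve ℚ) [W.IsElliptic] [W.IsGloballyMinimal] (p : ℕ) [Fact p.Prime]

/-- **`stub_fwLocus` of crux `KobayashiLowerHalfLargeImage`, EITHER rank, closed MODULO the OPEN binder.**
IF «FW Thm 5.1 ∘ Kobayashi Thm 7.4» (`hFW`, the FW half unrefereed) holds, then at every X7 pair with
`p ≠ 2`, `a_p = 0` and a non-split multiplicative prime `ℓ ≠ p` with `p ∤ ord_ℓ(Δ_min)`, the Eisenstein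
half of Kobayashi's main conjecture holds for SOME (indeed every) sign — verbatim the registered stub's
conclusion; `E[p]` irreducible is Serre's Prop 12 on X7 (`ClassX7.irr`); the stub's binders `¬CM`, `Surj`
are not needed for this reading and are omitted. CONDITIONAL; closes nothing.
[claim: FouquetWan2021, status: under-review] [cite: Kobayashi2003, Thm. 7.4 (p. 13) and Conjecture (p. 2)] -/
theorem X7.kobayashiLowerDivisibility_of_thm51_OPEN (hFW : FouquetWan2021_thm51_via_kobayashi74_OPEN)
    (hp : p ≠ 2) (hX : ClassX7 W p) (hap : W.frobeniusTrace p = 0)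
    (hloc : ∃ (ℓ : ℕ) (_ : Fact ℓ.Prime), ℓ ≠ p ∧ W.HasMultiplicativeReductionAtPrime ℓ ∧
        ¬ W.HasSplitMultiplicativeReductionAtPrime ℓ ∧ ¬ p ∣ padicValInt ℓ W.minimalDiscriminantInt) :
    ∃ ε : ℤˣ, KobayashiLowerDivisibility W p ε :=
  ⟨1, kobayashiLowerDivisibility_of_mainConjecture (hFW W p hp hX.1.1 hap (ClassX7.irr W p hp hX) hloc 1)⟩

/-- **X7 ∩ {r_an = 1} on the Fouquet–Wan locus: `BSD(E,p)` MODULO the OPEN binder**, via the tree's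
rank-one ± road (Burungale–Kobayashi–Ota 2024 Cor A.5 reading-fact `hA5`, modularity `hmod`, GZK `hGZK`).
This is the bulk of the cell window (917 of the 1 004 locus pairs are rank 1). CONDITIONAL; closes nothing.
[claim: FouquetWan2021, status: under-review] [cite: BurungaleKobayashiOta2023, App. A Cor. A.5]
[cite: Kobayashi2003, Thm. 7.4 (p. 13)] [cite: Miller2011LMS, §1 and Def. 1.1] -/
theorem X7.bsdp_of_thm51_OPEN_of_corA5_of_analyticRank_eq_one
    (hFW : FouquetWan2021_thm51_via_kobayashi74_OPEN)
    (hA5 : BurungaleKobayashiOta2024.corA5_pPart_of_signedCharIdeal_eq) (hmod : hasEntireLFunction_rat)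
    (hGZK : rank_eq_analyticRank_of_analyticRank_le_one)
    (hp : p ≠ 2) (hX : ClassX7 W p) (hap : W.frobeniusTrace p = 0)
    (hloc : ∃ (ℓ : ℕ) (_ : Fact ℓ.Prime), ℓ ≠ p ∧ W.HasMultiplicativeReductionAtPrime ℓ ∧
        ¬ W.HasSplitMultiplicativeReductionAtPrime ℓ ∧ ¬ p ∣ padicValInt ℓ W.minimalDiscriminantInt)
    (h1 : W.analyticRank = 1) : BSDp W p :=
  _root_.Summit.BirchSwinnertonDyer.Rank1Residual.Supersingular.bsdp_of_kobayashiMainConjecture_of_corA5_of_analyticRank_eq_one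
    W p hA5 hmod hGZK hp hX.1.1 hap h1 1
    (hFW W p hp hX.1.1 hap (ClassX7.irr W p hp hX) hloc 1)

/-- **X7 ∩ {r_an = 0} on the Fouquet–Wan locus: `BSD(E,p)` MODULO the OPEN binder**, via the tree's
image-free rank-zero ± road (Kobayashi Thm 1.2 `h12`, B. D. Kim Cor 3.15 `hKim`, Pollack `hPollack`,
modularity `hmod`/`hmod'`, GZK `hGZK`). Compare `FouquetWan2021.X7.bsdp_of_cor54_OPEN_of_analyticRank_eq_zero`
(the same conclusion from FW's own Cor 5.4 in print shape). CONDITIONAL; closes nothing.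
[claim: FouquetWan2021, status: under-review] [cite: Kobayashi2003, Thm. 1.2 and Thm. 7.4]
[cite: BDKim2013, Cor. 3.15 (p. 199)] [cite: Miller2011LMS, §1 and Def. 1.1] -/
theorem X7.bsdp_of_thm51_OPEN_of_analyticRank_eq_zero
    (hFW : FouquetWan2021_thm51_via_kobayashi74_OPEN)
    (h12 : Kobayashi2003.thm12_signedSelmerDual_finite_torsion)
    (hKim : BDKim2013.cor315_signedCharValue_rankZero)
    (hPollack : ∀ {N : ℕ} [NeZero N] {f : CuspForm (Gamma0 N) 2},
      pollack_exists_plusMinusPAdicLFunction (W := W) (f := f) (p := p))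
    (hmod : nonempty_modularParametrizationData) (hmod' : hasEntireLFunction_rat)
    (hGZK : rank_eq_analyticRank_of_analyticRank_le_one)
    (hp : p ≠ 2) (hX : ClassX7 W p) (hap : W.frobeniusTrace p = 0)
    (hloc : ∃ (ℓ : ℕ) (_ : Fact ℓ.Prime), ℓ ≠ p ∧ W.HasMultiplicativeReductionAtPrime ℓ ∧
        ¬ W.HasSplitMultiplicativeReductionAtPrime ℓ ∧ ¬ p ∣ padicValInt ℓ W.minimalDiscriminantInt)
    (h0 : W.analyticRank = 0) : BSDp W p :=
  _root_.Summit.BirchSwinnertonDyer.Rank1Residual.Supersingular.bsdp_of_kobayashiMainConjecture_of_analyticRank_eq_zero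
    W p h12 hKim hPollack hmod hmod' hGZK hp hX.1.1 hap (ClassX7.irr W p hp hX) h0
    (hFW W p hp hX.1.1 hap (ClassX7.irr W p hp hX) hloc 1)

/-- **The rank-0 print-shape binder follows from the ±-currency binder** (consistency of the two OPEN
transcriptions of Fouquet–Wan in the tree): «Thm 5.1 ∘ Kobayashi 7.4» + the published rank-zero ± road
give, at a rank-0 locus pair, Miller's `BSD(E,p)`, hence FW's Cor 5.4 print shape with `Ω⁺_f` in place of
`Ω_E` (the period comparison `h5`/`h3` makes the two shapes equiveridical). Stated as: the ± binder implies
`BSDp` wherever `cor54_pPart_rankZero_OPEN` would be invoked — see the theorem above; no separate claim.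
Bookkeeping remark only; this declaration restates `X7.bsdp_of_thm51_OPEN_of_analyticRank_eq_zero` for
the class-free hypothesis `GoodSS W p` instead of `ClassX7 W p`. [claim: FouquetWan2021, status: under-review]
[cite: Kobayashi2003, Thm. 1.2 and Thm. 7.4] [cite: BDKim2013, Cor. 3.15 (p. 199)] -/
theorem bsdp_of_thm51_OPEN_of_goodSS_of_analyticRank_eq_zero
    (hFW : FouquetWan2021_thm51_via_kobayashi74_OPEN)
    (h12 : Kobayashi2003.thm12_signedSelmerDual_finite_torsion)
    (hKim : BDKim2013.cor315_signedCharValue_rankZero)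
    (hPollack : ∀ {N : ℕ} [NeZero N] {f : CuspForm (Gamma0 N) 2},
      pollack_exists_plusMinusPAdicLFunction (W := W) (f := f) (p := p))
    (hmod : nonempty_modularParametrizationData) (hmod' : hasEntireLFunction_rat)
    (hGZK : rank_eq_analyticRank_of_analyticRank_le_one)
    (hp : p ≠ 2) (hss : GoodSS W p) (hap : W.frobeniusTrace p = 0)
    (hloc : ∃ (ℓ : ℕ) (_ : Fact ℓ.Prime), ℓ ≠ p ∧ W.HasMultiplicativeReductionAtPrime ℓ ∧
        ¬ W.HasSplitMultiplicativeReductionAtPrime ℓ ∧ ¬ p ∣ padicValInt ℓ W.minimalDiscriminantInt)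
    (h0 : W.analyticRank = 0) : BSDp W p :=
  have hirr : Irr W p :=
    hasIrreducibleModPGaloisRep_of_dvd_frobeniusTrace W p hp
      (W.not_dvd_minimalDiscriminantInt_of_hasGoodReductionAtPrime' p hss.1) hss.2
  bsdp_of_kobayashiMainConjecture_of_analyticRank_eq_zero W p h12 hKim hPollack hmod hmod' hGZK hp hss.1
    hap hirr h0 (hFW W p hp hss.1 hap hirr hloc 1)

end Summit.BirchSwinnertonDyer.Rank1Residual.Supersingular

end
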